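import Summits.AtomisticToContinuum.Crystallization.Theorems.FrustratedLawDichotomyStrainedPatchHomLatticeBoxHcp

/-!
# O(3) REDUCTION (polar factor) for the `HomFloor` certificate of the 27623 strained-patch piece

Critic row 764 (ε), CERT-DESIGN-g44 §0: every quantity of `(H)` depends on the deformation `G` only through the lengths
`‖G v‖`; hence `G` may be replaced by its symmetric positive POLAR FACTOR `U` (`G = R ∘ U`, `R` a linear isometry), and
`‖G − 1‖ ≤ 1/4` gives `‖U − 1‖ ≤ 1/4` (the singular values of `G` lie in `[3/4, 5/4]`).  The certificate therefore only has to
cover SELF-ADJOINT positive `U` with `‖U − 1‖ ≤ 1/4` (6 coordinates instead of 9).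

DEF-FREE.  Main results:
* `exists_polar_of_near_one` — for `‖G − 1‖ ≤ ε < 1`: `∃ (R : E3 ≃ₗᵢ[ℝ] E3) (U : E3 →L[ℝ] E3)`, `U` self-adjoint
  (`⟪U v, w⟫ = ⟪v, U w⟫`), positive (`0 ≤ ⟪w, U w⟫`), `‖U − 1‖ ≤ ε`, `‖U w‖ = ‖G w‖` and `G w = R (U w)` for all `w`
  (construction: `U = Σᵢ √μᵢ ⟪bᵢ, ·⟫ bᵢ` on an orthonormal eigenbasis of `G†G`);
* `forall_near_one_of_forall_selfAdjoint` — a property of deformations that is invariant under post-composition with linear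
  isometries holds for all `‖G − 1‖ ≤ 1/4` as soon as it holds for all self-adjoint positive `U` with `‖U − 1‖ ≤ 1/4`;
* `boxSum_fcc_reduction` / `boxSum_hcp_reduction` — the two BOX-SUM hypotheses of `…HomLatticeBoxHcp.homFloor_of_boxSums`
  (and the floor disjunct of any pruned variant) need only be certified for self-adjoint positive `U`, `‖U − 1‖ ≤ 1/4`.
decomp-a2c hand-1 g19; `--supports stmt-AtomisticToContinuum-27623`.
-/

noncomputable section

namespace Summit.AtomisticToContinuum.Crystallization.Theorems.FrustratedLawDichotomyStrainedPatchHomPolar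

open scoped BigOperators RealInnerProductSpace
open Summit.AtomisticToContinuum.Crystallization.Theorems.ChargedEnergyGapNegative (E3)
open Summit.AtomisticToContinuum.Crystallization.Theorems.FrustratedLawDichotomySchurCut (effPot w₄₅ ω₄)
open Summit.AtomisticToContinuum.Crystallization.Theorems.FrustratedLawDichotomyStrainedPatchHomSplit
open Literature.Barriers.AtomisticToContinuum.FlatleyTheil2015 (fccVec)

/-! ## §1. Two-sided length bounds from `‖G − 1‖ ≤ ε` -/

/-- `‖G w‖ ≤ (1 + ε)‖w‖`. [folklore] -/
theorem norm_apply_le_of_norm_sub_one_le {G : E3 →L[ℝ] E3} {ε : ℝ} (hG : ‖G - 1‖ ≤ ε) (w : E3) :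
    ‖G w‖ ≤ (1 + ε) * ‖w‖ := by
  have h1 : ‖(G - 1) w‖ ≤ ε * ‖w‖ := (ContinuousLinearMap.le_opNorm _ _).trans (mul_le_mul_of_nonneg_right hG (norm_nonneg _))
  have h2 : G w = (G - 1) w + w := by simp
  calc ‖G w‖ = ‖(G - 1) w + w‖ := by rw [← h2]
    _ ≤ ‖(G - 1) w‖ + ‖w‖ := norm_add_le _ _
    _ ≤ (1 + ε) * ‖w‖ := by linarith

/-- `(1 − ε)‖w‖ ≤ ‖G w‖`. [folklore] -/
theorem norm_apply_ge_of_norm_sub_one_le {G : E3 →L[ℝ] E3} {ε : ℝ} (hG : ‖G - 1‖ ≤ ε) (w : E3) :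
    (1 - ε) * ‖w‖ ≤ ‖G w‖ := by
  have h1 : ‖(G - 1) w‖ ≤ ε * ‖w‖ := (ContinuousLinearMap.le_opNorm _ _).trans (mul_le_mul_of_nonneg_right hG (norm_nonneg _))
  have h2 : w = G w - (G - 1) w := by simp
  have h3 : ‖w‖ ≤ ‖G w‖ + ‖(G - 1) w‖ := by
    calc ‖w‖ = ‖G w - (G - 1) w‖ := by rw [← h2]
      _ ≤ ‖G w‖ + ‖(G - 1) w‖ := norm_sub_le _ _
  linarith

/-! ## §2. Orthonormal-basis bookkeeping in `E3` -/

/-- Coefficient extraction: `⟪b j, Σᵢ cᵢ • b i⟫ = c j` for an orthonormal basis. [folklore] -/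
theorem inner_basis_sum_smul (b : OrthonormalBasis (Fin 3) ℝ E3) (c : Fin 3 → ℝ) (j : Fin 3) :
    ⟪b j, ∑ i, c i • b i⟫ = c j := by
  have hon := orthonormal_iff_ite.mp b.orthonormal
  rw [inner_sum]
  simp_rw [real_inner_smul_right, hon]
  simp [Finset.sum_ite_eq, Finset.mem_univ]

/-- Parseval, bilinear: `⟪v, w⟫ = Σⱼ ⟪b j, v⟫ ⟪b j, w⟫`. [folklore] -/
theorem inner_eq_sum_inner_basis (b : OrthonormalBasis (Fin 3) ℝ E3) (v w : E3) :
    ⟪v, w⟫ = ∑ j, ⟪b j, v⟫ * ⟪b j, w⟫ := by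
  rw [← b.sum_inner_mul_inner v w]
  exact Finset.sum_congr rfl fun j _ => by rw [real_inner_comm]

/-- Parseval: `‖v‖² = Σⱼ ⟪b j, v⟫²`. [folklore] -/
theorem norm_sq_eq_sum_inner_basis_sq (b : OrthonormalBasis (Fin 3) ℝ E3) (v : E3) :
    ‖v‖ ^ 2 = ∑ j, ⟪b j, v⟫ ^ 2 := by
  rw [← real_inner_self_eq_norm_sq, inner_eq_sum_inner_basis b]
  exact Finset.sum_congr rfl fun j _ => by ring

/-! ## §3. The polar factor -/

/-- ★★ **POLAR FACTOR.** For `‖G − 1‖ ≤ ε < 1` there are a linear isometry `R` and a self-adjoint positive `U` with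
`‖U − 1‖ ≤ ε`, `‖U w‖ = ‖G w‖` and `G = R ∘ U`.  (Spectral theorem for `G†G` on `E3`; `U = (G†G)^{1/2}`; the eigenvalues `μᵢ = ‖G bᵢ‖²`
of `G†G` lie in `[(1−ε)², (1+ε)²]`, so `|√μᵢ − 1| ≤ ε`.) [folklore: polar decomposition] -/
theorem exists_polar_of_near_one {G : E3 →L[ℝ] E3} {ε : ℝ} (hG : ‖G - 1‖ ≤ ε) (hε : ε < 1) :
    ∃ (R : E3 ≃ₗᵢ[ℝ] E3) (U : E3 →L[ℝ] E3), (∀ v w : E3, ⟪U v, w⟫ = ⟪v, U w⟫) ∧ (∀ w : E3, 0 ≤ ⟪w, U w⟫) ∧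
      ‖U - 1‖ ≤ ε ∧ (∀ w : E3, ‖U w‖ = ‖G w‖) ∧ ∀ w : E3, G w = R (U w) := by
  have hε0 : 0 ≤ ε := (norm_nonneg _).trans hG
  -- the symmetric operator `S = G†G`
  set S : E3 →ₗ[ℝ] E3 := ((ContinuousLinearMap.adjoint G).comp G).toLinearMap with hS
  have hSapp : ∀ v w : E3, ⟪v, S w⟫ = ⟪G v, G w⟫ := fun v w => by
    rw [hS]
    exact ContinuousLinearMap.adjoint_inner_right G v (G w)
  have hSsym : S.IsSymmetric := fun v w => by
    rw [real_inner_comm, hSapp, real_inner_comm, ← hSapp]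
  have h3 : Module.finrank ℝ E3 = 3 := finrank_euclideanSpace_fin
  set b : OrthonormalBasis (Fin 3) ℝ E3 := hSsym.eigenvectorBasis h3 with hb
  set μ : Fin 3 → ℝ := hSsym.eigenvalues h3 with hμ
  have hSb : ∀ i, S (b i) = μ i • b i := fun i => hSsym.apply_eigenvectorBasis h3 i
  have hbn : ∀ i, ‖b i‖ = 1 := fun i => b.orthonormal.1 i
  -- the eigenvalues are the squared lengths `‖G bᵢ‖²`, hence in `[(1−ε)², (1+ε)²]`
  have hμeq : ∀ i, μ i = ‖G (b i)‖ ^ 2 := fun i => by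
    have h1 : ⟪b i, S (b i)⟫ = μ i := by
      rw [hSb, real_inner_smul_right, real_inner_self_eq_norm_sq, hbn]; ring
    rw [← h1, hSapp, real_inner_self_eq_norm_sq]
  have hμnn : ∀ i, 0 ≤ μ i := fun i => by rw [hμeq]; positivity
  have hsqrtμ : ∀ i, Real.sqrt (μ i) = ‖G (b i)‖ := fun i => by rw [hμeq, Real.sqrt_sq (norm_nonneg _)]
  have hsq_le : ∀ i, |Real.sqrt (μ i) - 1| ≤ ε := fun i => by
    rw [hsqrtμ, abs_le]
    have hu := norm_apply_le_of_norm_sub_one_le hG (b i)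
    have hl := norm_apply_ge_of_norm_sub_one_le hG (b i)
    rw [hbn] at hu hl
    constructor <;> linarith
  -- the square root `U = Σ √μᵢ ⟪bᵢ, ·⟫ bᵢ`
  set Ul : E3 →ₗ[ℝ] E3 :=
    { toFun := fun w => ∑ i, (Real.sqrt (μ i) * ⟪b i, w⟫) • b i
      map_add' := fun v w => by
        simp only [inner_add_right, mul_add, add_smul, Finset.sum_add_distrib]
      map_smul' := fun r w => by
        simp only [real_inner_smul_right, RingHom.id_apply, Finset.smul_sum, smul_smul]
        exact Finset.sum_congr rfl fun i _ => by ring_nf } with hUl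
  have hUl_app : ∀ w, Ul w = ∑ i, (Real.sqrt (μ i) * ⟪b i, w⟫) • b i := fun w => rfl
  have hcoef : ∀ w j, ⟪b j, Ul w⟫ = Real.sqrt (μ j) * ⟪b j, w⟫ := fun w j => by
    rw [hUl_app, inner_basis_sum_smul]
  -- the two bilinear identities
  have hUU : ∀ v w, ⟪Ul v, Ul w⟫ = ∑ j, μ j * (⟪b j, v⟫ * ⟪b j, w⟫) := fun v w => by
    rw [inner_eq_sum_inner_basis b]
    refine Finset.sum_congr rfl fun j _ => ?_
    rw [hcoef, hcoef]
    have := Real.mul_self_sqrt (hμnn j)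
    calc Real.sqrt (μ j) * ⟪b j, v⟫ * (Real.sqrt (μ j) * ⟪b j, w⟫)
        = (Real.sqrt (μ j) * Real.sqrt (μ j)) * (⟪b j, v⟫ * ⟪b j, w⟫) := by ring
      _ = μ j * (⟪b j, v⟫ * ⟪b j, w⟫) := by rw [this]
  have hGG : ∀ v w, ⟪G v, G w⟫ = ∑ j, μ j * (⟪b j, v⟫ * ⟪b j, w⟫) := fun v w => by
    rw [← hSapp, inner_eq_sum_inner_basis b]
    refine Finset.sum_congr rfl fun j _ => ?_
    have : ⟪b j, S w⟫ = μ j * ⟪b j, w⟫ := by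
      rw [← hSsym (b j) w, hSb, real_inner_smul_left]
    rw [this]; ring
  have hnormU : ∀ w, ‖Ul w‖ = ‖G w‖ := fun w => by
    have h1 : ‖Ul w‖ ^ 2 = ‖G w‖ ^ 2 := by
      rw [← real_inner_self_eq_norm_sq, ← real_inner_self_eq_norm_sq, hUU, hGG]
    exact (pow_left_inj₀ (norm_nonneg _) (norm_nonneg _) two_ne_zero).1 h1
  -- self-adjointness and positivity
  have hUsym : ∀ v w, ⟪Ul v, w⟫ = ⟪v, Ul w⟫ := fun v w => by
    rw [inner_eq_sum_inner_basis b (Ul v), inner_eq_sum_inner_basis b v]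
    refine Finset.sum_congr rfl fun j _ => by rw [hcoef, hcoef]; ring
  have hUpos : ∀ w, 0 ≤ ⟪w, Ul w⟫ := fun w => by
    rw [inner_eq_sum_inner_basis b]
    refine Finset.sum_nonneg fun j _ => ?_
    rw [hcoef]
    have := Real.sqrt_nonneg (μ j)
    nlinarith [sq_nonneg ⟪b j, w⟫]
  -- `‖U − 1‖ ≤ ε`
  set U : E3 →L[ℝ] E3 := LinearMap.toContinuousLinearMap Ul with hU
  have hUapp : ∀ w, U w = Ul w := fun w => rfl
  have hU1 : ‖U - 1‖ ≤ ε := by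
    refine ContinuousLinearMap.opNorm_le_bound _ hε0 fun w => ?_
    have hsq : ‖(U - 1) w‖ ^ 2 ≤ (ε * ‖w‖) ^ 2 := by
      rw [norm_sq_eq_sum_inner_basis_sq b ((U - 1) w), mul_pow, norm_sq_eq_sum_inner_basis_sq b w, Finset.mul_sum]
      refine Finset.sum_le_sum fun j _ => ?_
      have hj : ⟪b j, (U - 1) w⟫ = (Real.sqrt (μ j) - 1) * ⟪b j, w⟫ := by
        rw [show (U - 1) w = Ul w - w from rfl, inner_sub_right, hcoef]; ring
      rw [hj, mul_pow]
      have h1 : (Real.sqrt (μ j) - 1) ^ 2 ≤ ε ^ 2 := by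
        rw [← sq_abs]; exact pow_le_pow_left₀ (abs_nonneg _) (hsq_le j) 2
      exact mul_le_mul_of_nonneg_right h1 (sq_nonneg _)
    have h0 : 0 ≤ ε * ‖w‖ := mul_nonneg hε0 (norm_nonneg _)
    exact (pow_le_pow_iff_left₀ (norm_nonneg _) h0 two_ne_zero).1 hsq
  -- injectivity of `U` and `G` (here `ε < 1` is used), and the isometry `R = G ∘ U⁻¹`
  have hGinj : Function.Injective (G : E3 →ₗ[ℝ] E3) := fun v w hvw => by
    have h0 : G (v - w) = 0 := by rw [map_sub]; exact sub_eq_zero.2 hvw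
    have h1 := norm_apply_ge_of_norm_sub_one_le hG (v - w)
    rw [h0, norm_zero] at h1
    have h2 : ‖v - w‖ ≤ 0 := by nlinarith [norm_nonneg (v - w)]
    exact sub_eq_zero.1 (norm_le_zero_iff.1 h2)
  have hUinj : Function.Injective Ul := fun v w hvw => by
    have h0 : Ul (v - w) = 0 := by rw [map_sub]; exact sub_eq_zero.2 hvw
    have h1 := norm_apply_ge_of_norm_sub_one_le hG (v - w)
    rw [← hnormU, h0, norm_zero] at h1
    have h2 : ‖v - w‖ ≤ 0 := by nlinarith [norm_nonneg (v - w)]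
    exact sub_eq_zero.1 (norm_le_zero_iff.1 h2)
  set Ue : E3 ≃ₗ[ℝ] E3 := LinearEquiv.ofInjectiveEndo Ul hUinj with hUe
  set Ge : E3 ≃ₗ[ℝ] E3 := LinearEquiv.ofInjectiveEndo (G : E3 →ₗ[ℝ] E3) hGinj with hGe
  have hUe_app : ∀ w, Ue w = Ul w := fun w => by rw [hUe, LinearEquiv.coe_ofInjectiveEndo]
  have hGe_app : ∀ w, Ge w = G w := fun w => by rw [hGe, LinearEquiv.coe_ofInjectiveEndo]; rfl
  set Re : E3 ≃ₗ[ℝ] E3 := Ue.symm.trans Ge with hRe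
  have hRe_app : ∀ v, Re v = G (Ue.symm v) := fun v => by rw [hRe, LinearEquiv.trans_apply, hGe_app]
  have hUlsymm : ∀ v, Ul (Ue.symm v) = v := fun v => by rw [← hUe_app, LinearEquiv.apply_symm_apply]
  have hRinner : ∀ v w, ⟪Re v, Re w⟫ = ⟪v, w⟫ := fun v w => by
    rw [hRe_app, hRe_app, hGG, ← hUU, hUlsymm, hUlsymm]
  refine ⟨Re.isometryOfInner hRinner, U, fun v w => hUsym v w, fun w => hUpos w, hU1, fun w => hnormU w, fun w => ?_⟩
  rw [LinearEquiv.coe_isometryOfInner, hRe_app, hUapp, ← hUe_app, LinearEquiv.symm_apply_apply]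

/-! ## §4. The reduction principle and the box-sum corollaries -/

/-- ★★ **O(3) REDUCTION.**  If a property `P` of deformations is invariant under post-composition with linear isometries, and
holds for every self-adjoint positive `U` with `‖U − 1‖ ≤ 1/4`, then it holds for every `G` with `‖G − 1‖ ≤ 1/4`. [folklore] -/
theorem forall_near_one_of_forall_selfAdjoint {P : (E3 →L[ℝ] E3) → Prop}
    (hinv : ∀ (R : E3 ≃ₗᵢ[ℝ] E3) (U : E3 →L[ℝ] E3), P U → P ((R : E3 →L[ℝ] E3).comp U))
    (hU : ∀ U : E3 →L[ℝ] E3, (∀ v w : E3, ⟪U v, w⟫ = ⟪v, U w⟫) → (∀ w : E3, 0 ≤ ⟪w, U w⟫) → ‖U - 1‖ ≤ 1 / 4 → P U) :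
    ∀ G : E3 →L[ℝ] E3, ‖G - 1‖ ≤ 1 / 4 → P G := by
  intro G hG
  obtain ⟨R, U, hsa, hpos, hU1, -, hGRU⟩ := exists_polar_of_near_one hG (by norm_num)
  have hG' : G = (R : E3 →L[ℝ] E3).comp U := by
    ext w : 1
    rw [hGRU w]; rfl
  rw [hG']
  exact hinv R U (hU U hsa hpos hU1)

/-- Lattice points transform covariantly: `latPt (R ∘ U) f b = R (latPt U f b)`. [formal bookkeeping] -/
theorem latPt_comp (R : E3 ≃ₗᵢ[ℝ] E3) (U : E3 →L[ℝ] E3) (f : Fin 3 → E3) (b : Fin 3 → ℤ) :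
    latPt ((R : E3 →L[ℝ] E3).comp U) f b = R (latPt U f b) := by
  rw [FrustratedLawDichotomyStrainedPatchHomLatticeBoxHcp.latPt_eq_apply_one,
    FrustratedLawDichotomyStrainedPatchHomLatticeBoxHcp.latPt_eq_apply_one U]
  rfl

/-- Lengths of lattice points are O(3)-invariant: `‖latPt (R ∘ U) f b‖ = ‖latPt U f b‖`. [folklore] -/
theorem norm_latPt_comp (R : E3 ≃ₗᵢ[ℝ] E3) (U : E3 →L[ℝ] E3) (f : Fin 3 → E3) (b : Fin 3 → ℤ) :
    ‖latPt ((R : E3 →L[ℝ] E3).comp U) f b‖ = ‖latPt U f b‖ := by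
  rw [latPt_comp, LinearIsometryEquiv.norm_map]

/-- Shifted (hcp `B`-sublattice) lengths are O(3)-invariant. [folklore] -/
theorem norm_latPt_add_comp (R : E3 ≃ₗᵢ[ℝ] E3) (U : E3 →L[ℝ] E3) (f : Fin 3 → E3) (b : Fin 3 → ℤ) (t : E3) :
    ‖latPt ((R : E3 →L[ℝ] E3).comp U) f b + ((R : E3 →L[ℝ] E3).comp U) t‖ = ‖latPt U f b + U t‖ := by
  rw [latPt_comp, ContinuousLinearMap.comp_apply]
  show ‖R (latPt U f b) + R (U t)‖ = _
  rw [← map_add, LinearIsometryEquiv.norm_map]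

/-- ★ **fcc BOX-SUM REDUCTION**: the fcc hypothesis of `homFloor_of_boxSums` (box `[−7,7]³ ∖ 0`, any summand `W ∘ ‖·‖`, any bound)
need only be certified for self-adjoint positive `U` with `‖U − 1‖ ≤ 1/4`. [folklore] -/
theorem boxSum_fcc_reduction {m e : ℝ} {W : ℝ → ℝ} {box : Finset (Fin 3 → ℤ)} {f : Fin 3 → E3}
    (hU : ∀ U : E3 →L[ℝ] E3, (∀ v w : E3, ⟪U v, w⟫ = ⟪v, U w⟫) → (∀ w : E3, 0 ≤ ⟪w, U w⟫) → ‖U - 1‖ ≤ 1 / 4 →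
      m ≤ (∑ b ∈ box, W ‖latPt U f b‖) / 2 - e) :
    ∀ G : E3 →L[ℝ] E3, ‖G - 1‖ ≤ 1 / 4 → m ≤ (∑ b ∈ box, W ‖latPt G f b‖) / 2 - e := by
  refine forall_near_one_of_forall_selfAdjoint (P := fun G => m ≤ (∑ b ∈ box, W ‖latPt G f b‖) / 2 - e) ?_ hU
  intro R U h
  simpa only [norm_latPt_comp] using h

/-- ★ **hcp BOX-SUM REDUCTION** (with the shuffle `ξ`, `‖ξ‖ ≤ 1/4`, as a parameter): the hcp hypothesis of `homFloor_of_boxSums`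
need only be certified for self-adjoint positive `U` with `‖U − 1‖ ≤ 1/4` (and every `ξ`). [folklore] -/
theorem boxSum_hcp_reduction {m e : ℝ} {W : ℝ → ℝ} {box box' : Finset (Fin 3 → ℤ)} {f : Fin 3 → E3} {s : E3}
    (hU : ∀ (U : E3 →L[ℝ] E3) (ξ : E3), (∀ v w : E3, ⟪U v, w⟫ = ⟪v, U w⟫) → (∀ w : E3, 0 ≤ ⟪w, U w⟫) →
      ‖U - 1‖ ≤ 1 / 4 → ‖ξ‖ ≤ 1 / 4 →
      m ≤ (∑ b ∈ box, W ‖latPt U f b‖ + ∑ b ∈ box', W ‖latPt U f b + U (s + ξ)‖) / 2 - e) :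
    ∀ (G : E3 →L[ℝ] E3) (ξ : E3), ‖G - 1‖ ≤ 1 / 4 → ‖ξ‖ ≤ 1 / 4 →
      m ≤ (∑ b ∈ box, W ‖latPt G f b‖ + ∑ b ∈ box', W ‖latPt G f b + G (s + ξ)‖) / 2 - e := by
  intro G ξ hG hξ
  revert hξ
  refine forall_near_one_of_forall_selfAdjoint
    (P := fun G => ‖ξ‖ ≤ 1 / 4 → m ≤ (∑ b ∈ box, W ‖latPt G f b‖ + ∑ b ∈ box', W ‖latPt G f b + G (s + ξ)‖) / 2 - e)
    ?_ (fun U hsa hpos hU1 hξ => hU U ξ hsa hpos hU1 hξ) G hG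
  intro R U h hξ
  simpa only [norm_latPt_comp, norm_latPt_add_comp] using h hξ

/-- ★★ **`HomFloor m` FROM THE REDUCED BOX-SUM CERTIFICATE**: the two hypotheses of `…HomLatticeBoxHcp.homFloor_of_boxSums` with `G`
restricted to self-adjoint positive `U`, `‖U − 1‖ ≤ 1/4`.  (Bare form — see critic row 764: the binding certificate target is the PRUNED
variant; this theorem is its floor-only special case and the template for re-using the two reductions above inside it.) [folklore] -/
theorem homFloor_of_boxSums_selfAdjoint {m : ℝ}
    (hfcc : ∀ U : E3 →L[ℝ] E3, (∀ v w : E3, ⟪U v, w⟫ = ⟪v, U w⟫) → (∀ w : E3, 0 ≤ ⟪w, U w⟫) → ‖U - 1‖ ≤ 1 / 4 →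
      m ≤ (∑ b ∈ (Fintype.piFinset fun _ : Fin 3 => Finset.Icc (-7 : ℤ) 7).filter (fun b => b ≠ 0),
        effPot w₄₅ ω₄ (3 / 400) ‖latPt U fccVec b‖) / 2 - (-(7175 / 10000) + 3 / 400))
    (hhcp : ∀ (U : E3 →L[ℝ] E3) (ξ : E3), (∀ v w : E3, ⟪U v, w⟫ = ⟪v, U w⟫) → (∀ w : E3, 0 ≤ ⟪w, U w⟫) →
      ‖U - 1‖ ≤ 1 / 4 → ‖ξ‖ ≤ 1 / 4 →
      m ≤ (∑ b ∈ (Fintype.piFinset fun _ : Fin 3 => Finset.Icc (-7 : ℤ) 7).filter (fun b => b ≠ 0),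
          effPot w₄₅ ω₄ (3 / 400) ‖latPt U hexFrame b‖ +
        ∑ b ∈ (Fintype.piFinset fun _ : Fin 3 => Finset.Icc (-7 : ℤ) 7),
          effPot w₄₅ ω₄ (3 / 400) ‖latPt U hexFrame b + U (hcpShift + ξ)‖) / 2 - (-(7175 / 10000) + 3 / 400)) :
    HomFloor m :=
  FrustratedLawDichotomyStrainedPatchHomLatticeBoxHcp.homFloor_of_boxSums (boxSum_fcc_reduction hfcc) (boxSum_hcp_reduction hhcp)

end Summit.AtomisticToContinuum.Crystallization.Theorems.FrustratedLawDichotomyStrainedPatchHomPolar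

end
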